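import Summits.BirchSwinnertonDyer.Rank1Residual.X11b.Three.LambdaSupplyTwistOrbit
import HarnessLib

/-!
# X11b @ `p = 3`, S28-c (K2) 'TWIST-SUPPLY', part 3: the ONE assembly lemma `hK2` of the S28-a glue
# (`Three.hsiehDescentAt₃_of_commonFrame`, r1's `S28-SKETCH.lean` v3) — every admissible `(λ, r_λ)`
# and every `η ∈ ℂ_p` with `η^{p^a} = 1` admit an admissible `(λ′, r_λ′)` with `r_λ′(γ) = η · r_λ(γ)`

HONEST FRAMING (cell `b2b-bsdres`, run/shared/lean/b2b/bsd-rank1-residual/, verbatim in every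
file): the goal of the cell is to DELETE the COMBINATION-SHAPED residual classes of the
Birch–Swinnerton-Dyer formula for ALL analytic-rank `≤ 1` elliptic curves over `ℚ` — assembled
STRICTLY from published theorems — so that the rank-`≤ 1` remainder becomes exactly the
CONSTRUCTION-SHAPED classes, which are TYPED, NOT attempted. This is not "finishing BSD". Team N8/O2
(X11b at `3`): research route; nothing booked; NO label changes; O2 stays OPEN; S28 RE-EXPRESSES the
descent node (a READING — H45: nothing 'shrinks'). THEOREMS ONLY; no definition, no fact, no `sorry`.

PROVENANCE: S28-c (K2) (lead GEN 7 R8-22 (d) / R8-30 / R8-33 (c)), seat `b2b-bsdres-x11b3-p2` (gen. 4),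
after parts 1–2 (`LambdaSupplyTwistFamily`, `LambdaSupplyTwistOrbit`: (K2-a) `twist_admissible`,
(K2-b) `quotient_admissible`, (K2-c), (K2-d), (K2-e) `exists_admissible_twist_of_pow_eq_one`). This file
assembles them into the `∃`-form binder **`hK2`** of r1 GEN 8's sketch
(`HOME/b2b-bsdres-x11b3-r1/S28-SKETCH.lean` v3, `inter_subset_unrIntegers_of_supplies` /
`hsiehDescentAt₃_of_commonFrame`; r2 GEN 9 N6: "ONE assembly lemma with this signature VERBATIM"):
`twistSupply₃` below has that signature at `p = 3` (general odd `p`: `exists_admissible_twist_mul`).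
The bridge `ℂ_p ⊇ μ_{p^∞} ⊆ ℚ̄_p` (`exists_padicAlgCl_coe_eq_of_pow_eq_one`) is r1 GEN 8's courtesy
lemma (§5 of the sketch), reproduced here with credit so that it enters the tree.

## What this file proves

* `exists_padicAlgCl_coe_eq_of_pow_eq_one` (r1): a `p^a`-th root of unity of `ℂ_p` comes from `ℚ̄_p`.
* `avatarValueAt_unitsChar`, `avatarValueAt_unitsChar_mul`: `r(γ)` in the `e ∘ ψ` currency and its
  multiplicativity in `ψ`.
* **`exists_admissible_twist_mul`** (any odd `p`; `K` imaginary quadratic): (λ, r_λ) admissible (the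
  six Hsieh clauses), `η ∈ ℂ_p`, `η^{p^a} = 1` ⇒ ∃ admissible (λ′, r_λ′) with
  `avatarValueAt r_λ′ γ = η * avatarValueAt r_λ γ` — (K2-e) gives `ε = (μ, r_μ)` with `r_μ(γ) = η`,
  (K2-a) twists.
* **`twistSupply₃`**: the `p = 3` instance in the binder shape of the sketch (hypotheses
  `IsImaginaryQuadratic K`, `#{𝔭 ∣ 3} = 2` (carried, unused), `κ.IsAnticyclotomic`, `κ.IsTopGenerator γ`).

## References

* M.-L. Hsieh, *Special values of anticyclotomic Rankin–Selberg L-functions*, Doc. Math. 19 (2014),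
  Prop. 5.5 (admissible twists `λε`). [Hsieh2014]
* R. Greenberg, *Non-vanishing of certain values of `L`-functions* (1987), §2. [Greenberg1987]
-/

noncomputable section

open scoped NumberField Polynomial
open NumberField IsDedekindDomain Field Polynomial Filter
  Literature.NumberTheory.GaloisRepresentations Literature.NumberTheory.EllipticCurves
  Literature.NumberTheory.Automorphic

namespace Summit.BirchSwinnertonDyer.Rank1Residual.X11b.Three.LambdaSupply

variable {K : Type} [Field K] [NumberField K] {p : ℕ} [Fact p.Prime]

/-! ### §9. Roots of unity of `ℂ_p` come from `ℚ̄_p` (r1 GEN 8, S28-SKETCH §5) -/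

omit [Field K] [NumberField K] in
/-- A `p^a`-th root of unity of `ℂ_p` is the image of a `p^a`-th root of unity of `ℚ̄_p = PadicAlgCl p`
(both fields contain a primitive one, `ℚ̄_p` being algebraically closed, and the inclusion is
injective). Courtesy lemma of x11b3-r1 GEN 8 (`S28-SKETCH.lean` §5), entered here. [folklore] -/
theorem exists_padicAlgCl_coe_eq_of_pow_eq_one {a : ℕ} {η : ℂ_[p]} (hη : η ^ p ^ a = 1) :
    ∃ η' : PadicAlgCl p, η' ^ p ^ a = 1 ∧ (η' : ℂ_[p]) = η := by
  haveI : NeZero (p ^ a) := ⟨pow_ne_zero _ (Fact.out : p.Prime).ne_zero⟩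
  obtain ⟨ζ, hζ⟩ := HasEnoughRootsOfUnity.prim (M := PadicAlgCl p) (n := p ^ a)
  have hζ' : IsPrimitiveRoot (algebraMap (PadicAlgCl p) ℂ_[p] ζ) (p ^ a) :=
    hζ.map_of_injective (algebraMap (PadicAlgCl p) ℂ_[p]).injective
  obtain ⟨i, -, hi⟩ := hζ'.eq_pow_of_pow_eq_one hη
  refine ⟨ζ ^ i, ?_, ?_⟩
  · rw [← pow_mul, mul_comm, pow_mul, hζ.pow_eq_one, one_pow]
  · rw [PadicComplex.coe_eq, map_pow, hi]

/-! ### §10. `avatarValueAt` in the `e ∘ ψ` currency -/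

omit [NumberField K] in
/-- `r(γ)` for `r = e ∘ ψ` is `ψ(γ) ∈ ℚ̄_p ⊂ ℂ_p`. [folklore] -/
theorem avatarValueAt_unitsChar (ψ : absoluteGaloisGroup K →ₜ* (PadicAlgCl p)ˣ)
    (γ : absoluteGaloisGroup K) :
    avatarValueAt ((FramedRep.unitsContinuousMulEquivOfUnique (Fin 1) (PadicAlgCl p) :
      (PadicAlgCl p)ˣ →ₜ* GL (Fin 1) (PadicAlgCl p)).comp ψ) γ = (((ψ γ : (PadicAlgCl p)ˣ) : PadicAlgCl p) : ℂ_[p]) := by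
  rw [avatarValueAt, Matrix.GeneralLinearGroup.val_det_apply, Matrix.det_fin_one, unitsChar_apply_coe]

omit [NumberField K] in
/-- Multiplicativity in `ψ`: `(e ∘ (ψ ψ'))(γ) = (e ∘ ψ)(γ) · (e ∘ ψ')(γ)` in `ℂ_p`. [folklore] -/
theorem avatarValueAt_unitsChar_mul (ψ ψ' : absoluteGaloisGroup K →ₜ* (PadicAlgCl p)ˣ)
    (γ : absoluteGaloisGroup K) :
    avatarValueAt ((FramedRep.unitsContinuousMulEquivOfUnique (Fin 1) (PadicAlgCl p) :
      (PadicAlgCl p)ˣ →ₜ* GL (Fin 1) (PadicAlgCl p)).comp (ψ * ψ')) γ =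
    avatarValueAt ((FramedRep.unitsContinuousMulEquivOfUnique (Fin 1) (PadicAlgCl p) :
      (PadicAlgCl p)ˣ →ₜ* GL (Fin 1) (PadicAlgCl p)).comp ψ) γ *
    avatarValueAt ((FramedRep.unitsContinuousMulEquivOfUnique (Fin 1) (PadicAlgCl p) :
      (PadicAlgCl p)ˣ →ₜ* GL (Fin 1) (PadicAlgCl p)).comp ψ') γ := by
  rw [avatarValueAt_unitsChar, avatarValueAt_unitsChar, avatarValueAt_unitsChar,
    ContinuousMonoidHom.mul_apply, Units.val_mul, UniformSpace.Completion.coe_mul]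

/-! ### §11. The assembly: `hK2` of the S28-a glue -/

/-- **(K2) TWIST SUPPLY in the `∃`-form the S28-a glue consumes** (any odd prime `p`; `K` imaginary
quadratic): every admissible `(λ, r_λ)` (the six clauses [08]–[13] of
`hsieh2014_exists_anticyclotomicPAdicLFunction`) and every `η ∈ ℂ_p` with `η^{p^a} = 1` admit an
admissible `(λ′, r_λ′)` with `r_λ′(γ) = η · r_λ(γ)`: lift `η` to `ℚ̄_p`
(`exists_padicAlgCl_coe_eq_of_pow_eq_one`), take `ε = (μ, r_μ)` with `r_μ(γ) = η` by (K2-e)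
`exists_admissible_twist_of_pow_eq_one`, twist by (K2-a) `twist_admissible`. [cite: Hsieh2014, Prop. 5.5] -/
theorem exists_admissible_twist_mul (hK : IsImaginaryQuadratic K) (hp : p ≠ 2)
    (ι : PadicAlgCl p ≃+* ℂ) {κ : ZpExtension K p} {γ : absoluteGaloisGroup K}
    (hκ : κ.IsAnticyclotomic) (hγ : κ.IsTopGenerator γ)
    (lam : HeckeCharacter K) (rlam : FramedGaloisRep K (PadicAlgCl p) 1)
    (h8 : lam.IsUnitary) (h9 : lam.HasInfinityType (fun _ ↦ (1 : ℤ)) (fun _ ↦ (-1 : ℤ)))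
    (h10 : ∀ x : ideleGroup ℚ, lam (AdeleRing.ideleBaseChange ℚ K x) = 1)
    (h11 : ∀ v : HeightOneSpectrum (𝓞 K), ((p : ℕ) : 𝓞 K) ∉ v.asIdeal → lam.IsUnramifiedAt v)
    (h12 : IsPAdicAvatarOf ι lam rlam) (h13 : FactorsThroughZp κ rlam)
    (η : ℂ_[p]) (a : ℕ) (hη : η ^ p ^ a = 1) :
    ∃ (lam' : HeckeCharacter K) (rlam' : FramedGaloisRep K (PadicAlgCl p) 1),
      lam'.IsUnitary ∧ lam'.HasInfinityType (fun _ ↦ (1 : ℤ)) (fun _ ↦ (-1 : ℤ)) ∧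
      (∀ x : ideleGroup ℚ, lam' (AdeleRing.ideleBaseChange ℚ K x) = 1) ∧
      (∀ v : HeightOneSpectrum (𝓞 K), ((p : ℕ) : 𝓞 K) ∉ v.asIdeal → lam'.IsUnramifiedAt v) ∧
      IsPAdicAvatarOf ι lam' rlam' ∧ FactorsThroughZp κ rlam' ∧
      avatarValueAt rlam' γ = η * avatarValueAt rlam γ := by
  obtain ⟨h2, _⟩ := hK
  haveI : Algebra.IsQuadraticExtension ℚ K := ⟨h2⟩
  haveI : IsGalois ℚ K := inferInstance
  -- `η` from `ℚ̄_p`, the twist `ε = (μ, r_μ)` with `r_μ(γ) = η`, and (K2-a)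
  obtain ⟨η', hη', hcoe⟩ := exists_padicAlgCl_coe_eq_of_pow_eq_one hη
  obtain ⟨μ, rμ, hμk, hμ11, hμ12, hμ13, hval⟩ := exists_admissible_twist_of_pow_eq_one ι hγ hη'
  obtain ⟨c8, c9, c10, c11, c12, c13⟩ :=
    twist_admissible h2 hp ι hκ h8 h9 h10 h11 h12 h13 hμk hμ11 hμ12 hμ13
  refine ⟨lam * μ, _, c8, c9, c10, c11, c12, c13, ?_⟩
  -- the value at `γ`
  have hr : avatarValueAt rlam γ = avatarValueAt ((FramedRep.unitsContinuousMulEquivOfUnique (Fin 1)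
      (PadicAlgCl p) : (PadicAlgCl p)ˣ →ₜ* GL (Fin 1) (PadicAlgCl p)).comp
      (((FramedRep.unitsContinuousMulEquivOfUnique (Fin 1) (PadicAlgCl p)).symm :
        GL (Fin 1) (PadicAlgCl p) →ₜ* (PadicAlgCl p)ˣ).comp rlam)) γ := by rw [comp_symm_comp_eq]
  have hrμ : avatarValueAt rμ γ = avatarValueAt ((FramedRep.unitsContinuousMulEquivOfUnique (Fin 1)
      (PadicAlgCl p) : (PadicAlgCl p)ˣ →ₜ* GL (Fin 1) (PadicAlgCl p)).comp
      (((FramedRep.unitsContinuousMulEquivOfUnique (Fin 1) (PadicAlgCl p)).symm :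
        GL (Fin 1) (PadicAlgCl p) →ₜ* (PadicAlgCl p)ˣ).comp rμ)) γ := by rw [comp_symm_comp_eq]
  rw [avatarValueAt_unitsChar_mul, ← hr, ← hrμ, hval, hcoe, mul_comm]

/-- **`hK2` at `p = 3`, VERBATIM the binder of r1's `inter_subset_unrIntegers_of_supplies` /
`Three.hsiehDescentAt₃_of_commonFrame`** (`S28-SKETCH.lean` v3): the twist supply for every imaginary
quadratic `K` (the Heegner-type hypothesis `#{𝔭 ∣ 3} = 2` is carried for signature identity and not
used), every anticyclotomic `κ` with topological generator `γ`, every admissible `(λ, r_λ)` and every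
`η ∈ ℂ₃` with `η^{3^a} = 1`. [cite: Hsieh2014, Prop. 5.5] -/
theorem twistSupply₃ :
    ∀ (ι' : PadicAlgCl 3 ≃+* ℂ) (K : Type) [Field K] [NumberField K] (κ : ZpExtension K 3)
      (γ : absoluteGaloisGroup K), IsImaginaryQuadratic K →
      ((Ideal.span {(3 : ℤ)}).primesOver (𝓞 K)).ncard = 2 → κ.IsAnticyclotomic → κ.IsTopGenerator γ →
      ∀ (lam : HeckeCharacter K) (rlam : FramedGaloisRep K (PadicAlgCl 3) 1),
        lam.IsUnitary → lam.HasInfinityType (fun _ ↦ (1 : ℤ)) (fun _ ↦ (-1 : ℤ)) →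
        (∀ x : ideleGroup ℚ, lam (AdeleRing.ideleBaseChange ℚ K x) = 1) →
        (∀ v : HeightOneSpectrum (𝓞 K), ((3 : ℕ) : 𝓞 K) ∉ v.asIdeal → lam.IsUnramifiedAt v) →
        IsPAdicAvatarOf ι' lam rlam → FactorsThroughZp κ rlam →
        ∀ (η : ℂ_[3]) (a : ℕ), η ^ 3 ^ a = 1 →
          ∃ (lam' : HeckeCharacter K) (rlam' : FramedGaloisRep K (PadicAlgCl 3) 1),
            lam'.IsUnitary ∧ lam'.HasInfinityType (fun _ ↦ (1 : ℤ)) (fun _ ↦ (-1 : ℤ)) ∧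
            (∀ x : ideleGroup ℚ, lam' (AdeleRing.ideleBaseChange ℚ K x) = 1) ∧
            (∀ v : HeightOneSpectrum (𝓞 K), ((3 : ℕ) : 𝓞 K) ∉ v.asIdeal → lam'.IsUnramifiedAt v) ∧
            IsPAdicAvatarOf ι' lam' rlam' ∧ FactorsThroughZp κ rlam' ∧
            avatarValueAt rlam' γ = η * avatarValueAt rlam γ := by
  haveI : Fact (Nat.Prime 3) := ⟨Nat.prime_three⟩
  intro ι' K _ _ κ γ hK _ hκ hγ lam rlam h8 h9 h10 h11 h12 h13 η a hη
  exact exists_admissible_twist_mul hK (by norm_num) ι' hκ hγ lam rlam h8 h9 h10 h11 h12 h13 η a hη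

end Summit.BirchSwinnertonDyer.Rank1Residual.X11b.Three.LambdaSupply

end
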